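import Summits.CriticalPhenomena.PercolationContinuityZ3.Theorems.Transplant.SkelPhiRunKitClauseHab
import Summits.CriticalPhenomena.PercolationContinuityZ3.Theorems.Transplant.SkelPhiParaVLocDChain
import Summits.CriticalPhenomena.PercolationContinuityZ3.Theorems.Transplant.SkelPhiParaBandW
import HarnessLib

/-!
# N1 (the `{±1}` node), (C) column file (C-S3w): THE ROUTE SETS OF THE WINDOWED BANDS — the per-contact route datum `∃ Qt Ft, Ft ⊆ T ∧ Qt ⊆ Dr ∧
# Disjoint Ft Z ∧ 1 − δ² < P_W(link Qt SEED Ft)` of p1's `kitClause_runXGHab` for a band step of the windowed x-band `xPrmWw … Wm Wp` (u-corridor)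
# and the windowed y′-band `yPrmXw … Wm Wp` (v-corridor) in the one frame `runX φ c₀ n h 1` — (C-S3)'s `routeSetsN_xbandIn/_ybandIn` verbatim
# over the windowed records of (C-N9w) (the steering window never enters the route sets: link box and pieces are unchanged).

builds on p205010 (kernel theorem, internal audit signed; external expert review pending) — nothing in this file uses p205010; nothing here is a
claim about the open node `SamePDropOfSkeletonNeg`.
Lane `prim-bschramm`, seat `prim-bschramm-p5` (gen 9; (C) lineage); helper file (`--supports stmt-CriticalPhenomena-4575`).
[cite: KozmaNitzan2024, §4 Lemma 10 Step IV (pp. 20–21), Lemma 11 (pp. 22–23)] [cite: MartineauTassion2017, §4.3 Lemma 4.2]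
-/

noncomputable section

open scoped Classical

namespace Summit.CriticalPhenomena.PercolationContinuityZ3.Theorems.Transplant

namespace Skelφ

open MeasureTheory ProbabilityTheory
open Literature.Probability.Percolation Literature.Probability.LatticeModels SimpleGraph KNLevels
open Literature.Barriers.CriticalPhenomena (graphBall graphBall_mono)
open Skel (winGraph winGraph_le winGraphIn winGraphIn_le)
open ChainPlanar ChainPara

variable {V : Type} {G : SimpleGraph V} {φ : V → Site 2}

/-- The common last step: a certified link inside `Qt = pgramPrismFin c …` with `Qt ⊆ Dr ⊆ Ω` transfers from `P_q` to the subbox weighting of the habitat graph.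
[cite: KozmaNitzan2024, §4 Lemma 10 Step IV (p. 21)] -/
private theorem transfer_prismFin [DecidableEq V] [Countable V] [G.LocallyFinite] {c : V} {n : ℕ} {h : ℤ} {ℓ Rl : ℕ} {Dr Ω : Finset V}
    (hQD : pgramPrismFin G φ c n h (3 * ℓ) Rl ⊆ Dr) (hDrΩ : Dr ⊆ Ω) {q : unitInterval} {Wt : Sym2 V → unitInterval} (hWD : IsSubbox (winGraphIn G Ω) Wt q Dr)
    (SEED Ft : Finset V) (hFt : (↑Ft : Set V) ⊆ pgramPrism G φ c n h (3 * ℓ) Rl) {δ₂ : ℝ}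
    (hev : 1 - δ₂ < (bondPercolation G q).real (linkIn (pgramPrism G φ c n h (3 * ℓ) Rl) SEED Ft)) :
    1 - δ₂ < (prodBernoulli Wt).real (linkIn (↑(pgramPrismFin G φ c n h (3 * ℓ) Rl) : Set V) SEED Ft) := by
  have hcoe : (↑(pgramPrismFin G φ c n h (3 * ℓ) Rl) : Set V) = pgramPrism G φ c n h (3 * ℓ) Rl := by ext w; simp
  have _ := hFt
  have heq := Skel.real_eq_of_isSubbox_of_le (winGraphIn_le G Ω) hWD hQD (Skel.adj_winGraphIn_of_subset (hQD.trans hDrΩ))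
    (determinedBy_linkIn (↑(pgramPrismFin G φ c n h (3 * ℓ) Rl)) SEED Ft subset_rfl) (measurableSet_linkIn _ _ _)
  rw [heq, hcoe]
  exact hev

/-! ## The windowed band record of the corridor by axis -/

/-- **The windowed band record of the corridor along `du`**: the windowed x-band `xPrmWw` (window `Wx` both sides) for a u-corridor (`du.1 = 0`),
the windowed y′-band `yPrmXw` (window `[−Wmy, Wpy]`, drift `v`) for a v-corridor (`du.1 = 1`). [this work] -/
def bandNw (n ℓ : ℕ) (h v : ℤ) (R' qx Nx qy Ny Wx Wmy Wpy : ℕ) (du : MDir) : RunPrm :=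
  if du.1 = 0 then xPrmWw n ℓ h R' qx Nx Wx Wx else yPrmXw n ℓ h v R' qy Ny Wmy Wpy

/-- The windowed band record is admissible (`1 ≤ n`, `|v| ≤ n`, two layers, pieces inside the windows). [folklore] -/
theorem bandNw_ok {n ℓ : ℕ} {h v : ℤ} (hn : 1 ≤ n) (hv : |v| ≤ n) (hlay : 2 * ((n + h.natAbs : ℕ) : ℤ) ≤ (n : ℤ) * ℓ + 1) (R' qx Nx qy Ny : ℕ)
    {Wx Wmy Wpy : ℕ} (hWx : n * ℓ / shearUnit n h + 1 ≤ Wx) (hWmy : (n + v).toNat ≤ Wmy) (hWpy : (n - v).toNat ≤ Wpy) (du : MDir) :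
    RunOK (bandNw n ℓ h v R' qx Nx qy Ny Wx Wmy Wpy du) := by
  unfold bandNw; split_ifs
  · exact xPrmWw_ok n ℓ h R' qx Nx hWx hWx
  · exact yPrmXw_ok hn hv hlay R' qy Ny hWmy hWpy

/-- `eb = ea` for the windowed band record. [folklore] -/
theorem bandNw_eb (n ℓ : ℕ) (h v : ℤ) (R' qx Nx qy Ny Wx Wmy Wpy : ℕ) (du : MDir) :
    (bandNw n ℓ h v R' qx Nx qy Ny Wx Wmy Wpy du).eb = (bandNw n ℓ h v R' qx Nx qy Ny Wx Wmy Wpy du).ea := by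
  unfold bandNw; split_ifs <;> rfl

/-- The windowed band's along slack is `R'`. [folklore] -/
theorem bandNw_ea (n ℓ : ℕ) (h v : ℤ) (R' qx Nx qy Ny Wx Wmy Wpy : ℕ) (du : MDir) : (bandNw n ℓ h v R' qx Nx qy Ny Wx Wmy Wpy du).ea = R' := by
  unfold bandNw; split_ifs <;> rfl

/-! ## The route sets of the windowed band steps -/

/-- **THE ROUTE SETS OF A SIGNED x-BAND STRIDE WITH A FREE WINDOW (segment C, u-corridor)**: band sign `σB`, `Ft := pgSideHalfW c n h ℓ Rl σB (σB·τₖ)` with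
`τₖ = steer k (σB·runX c 1)`; `Ft ⊆ T`, `Qt ⊆ Dr`, `Ft` off the zone box (`Mz < n`), certificate transferred.
[cite: KozmaNitzan2024, §4 Lemma 10 Step IV (pp. 20–21), Lemma 11 (pp. 22–23)] [cite: MartineauTassion2017, §4.3 Lemma 4.2] -/
theorem routeSetsN_xbandWIn [DecidableEq V] [Countable V] [G.LocallyFinite] {n ℓ : ℕ} (hn : 1 ≤ n) (c₀ : V) (h : ℤ) {σB : ℤ} (hσB : σB = 1 ∨ σB = -1)
    (R' qB N : ℕ) {Wm Wp : ℕ}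
    (hWm : n * ℓ / shearUnit n h + 1 ≤ Wm) (hWp : n * ℓ / shearUnit n h + 1 ≤ Wp) {w₀ c : V} {R r Rl k Mz : ℕ}
    (hc : runX φ c₀ n h 1 c ∈ Finset.Icc (((xPrmWw n ℓ h R' qB N Wm Wp).scheduleN 0 hσB 0 (xPrmWw_ok n ℓ h R' qB N hWm hWp) (xPrmWw_eb n ℓ h R' qB N Wm Wp)).lo k -
        ((((xPrmWw n ℓ h R' qB N Wm Wp).scheduleN 0 hσB 0 (xPrmWw_ok n ℓ h R' qB N hWm hWp) (xPrmWw_eb n ℓ h R' qB N Wm Wp)).R' : ℕ) : Site 2))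
      (((xPrmWw n ℓ h R' qB N Wm Wp).scheduleN 0 hσB 0 (xPrmWw_ok n ℓ h R' qB N hWm hWp) (xPrmWw_eb n ℓ h R' qB N Wm Wp)).hi k +
        ((((xPrmWw n ℓ h R' qB N Wm Wp).scheduleN 0 hσB 0 (xPrmWw_ok n ℓ h R' qB N hWm hWp) (xPrmWw_eb n ℓ h R' qB N Wm Wp)).R' : ℕ) : Site 2)))
    (hcw : c ∈ graphBall G w₀ (R - r)) (hr : Rl ≤ r) (hrR : r ≤ R) {Z : Finset V} (hZ : (↑Z : Set V) ⊆ cyl φ c Mz) (hMz : Mz < n)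
    {Dr T : Finset V}
    (hPD : Win G (runX φ c₀ n h 1) w₀ (((xPrmWw n ℓ h R' qB N Wm Wp).scheduleN 0 hσB 0 (xPrmWw_ok n ℓ h R' qB N hWm hWp) (xPrmWw_eb n ℓ h R' qB N Wm Wp)).region k) R ⊆ Dr)
    (hPT : Win G (runX φ c₀ n h 1) w₀ (((xPrmWw n ℓ h R' qB N Wm Wp).scheduleN 0 hσB 0 (xPrmWw_ok n ℓ h R' qB N hWm hWp) (xPrmWw_eb n ℓ h R' qB N Wm Wp)).core (k + 1)) R ⊆ T)
    {Ω : Finset V} (hDrΩ : Dr ⊆ Ω) {q : unitInterval} {Wt : Sym2 V → unitInterval} (hWD : IsSubbox (winGraphIn G Ω) Wt q Dr) {SEED : Finset V} {δ₂ : ℝ}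
    (hev : 1 - δ₂ < (bondPercolation G q).real (linkIn (pgramPrism G φ c n h (3 * ℓ) Rl) SEED
      (pgSideHalfW G φ c n h ℓ Rl σB (σB * (xPrmWw n ℓ h R' qB N Wm Wp).steer k (σB * runX φ c₀ n h 1 c 1))))) :
    ∃ Qt Ft : Finset V, Ft ⊆ T ∧ Qt ⊆ Dr ∧ Disjoint Ft Z ∧ 1 - δ₂ < (prodBernoulli Wt).real (linkIn (↑Qt : Set V) SEED Ft) := by
  set τ₀ := (xPrmWw n ℓ h R' qB N Wm Wp).steer k (σB * runX φ c₀ n h 1 c 1) with hτ₀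
  have hQB : ∀ w ∈ pgramPrism G φ c n h (3 * ℓ) Rl, w ∈ graphBall G w₀ R := fun w hw =>
    pgramPrism_subset_graphBall_of_mem hcw hr hrR n h (3 * ℓ) hw
  have hQD : pgramPrismFin G φ c n h (3 * ℓ) Rl ⊆ Dr := fun w hw => by
    have hw' := (mem_pgramPrismFin G φ).1 hw
    exact hPD ((mem_Win G _).2 ⟨hQB w hw', runX_mem_xbandWRegion_of_link hn c₀ h hσB R' qB N hWm hWp hc hw'⟩)
  have hFt : (↑(pgSideHalfW G φ c n h ℓ Rl σB (σB * τ₀)) : Set V) ⊆ pgramPrism G φ c n h (3 * ℓ) Rl :=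
    coe_pgSideHalfW_subset (G := G) (φ := φ) c n h ℓ Rl σB _
  refine ⟨pgramPrismFin G φ c n h (3 * ℓ) Rl, pgSideHalfW G φ c n h ℓ Rl σB (σB * τ₀), fun w hw => ?_, hQD, ?_,
    transfer_prismFin hQD hDrΩ hWD SEED _ hFt hev⟩
  · have hw' : w ∈ pgramPrism G φ c n h (3 * ℓ) Rl := hFt (Finset.mem_coe.2 hw)
    exact hPT ((mem_Win G _).2 ⟨hQB w hw', runX_mem_xbandWCore_succ_of_piece hn c₀ h hσB R' qB N hWm hWp hc hw⟩)
  · have hd := disjoint_pgSideHalfW_cyl (G := G) (φ := φ) c hMz h ℓ Rl hσB (σB * τ₀)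
    exact Finset.disjoint_left.2 fun w hw hz => Set.disjoint_left.1 hd (Finset.mem_coe.2 hw) (hZ (Finset.mem_coe.2 hz))

/-- **THE ROUTE SETS OF A SIGNED y′-BAND STRIDE WITH A FREE WINDOW (segment C, v-corridor)**: band sign `σB`, drift `v`, `Ft := pgTopPieceW c n h ℓ Rl σB τₖ v` with
`τₖ = steer k (σB·runX c 0)`; `Ft ⊆ T`, `Qt ⊆ Dr`, `Ft` off the zone box (clearance `(Mz+4)(n+|h|) ≤ n(ℓ+1)`), certificate transferred.
[cite: KozmaNitzan2024, §4 Lemma 10 Step IV (pp. 20–21), Lemma 11 (pp. 22–23)] [cite: MartineauTassion2017, §4.3 Lemma 4.2] -/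
theorem routeSetsN_ybandWIn [DecidableEq V] [Countable V] [G.LocallyFinite] {n ℓ : ℕ} {h v : ℤ} (hn : 1 ≤ n) (hv : |v| ≤ n)
    (hlay : 2 * ((n + h.natAbs : ℕ) : ℤ) ≤ (n : ℤ) * ℓ + 1) (c₀ : V) {σB : ℤ} (hσB : σB = 1 ∨ σB = -1) (R' qB N : ℕ) {Wm Wp : ℕ}
    (hWm : (n + v).toNat ≤ Wm) (hWp : (n - v).toNat ≤ Wp) {w₀ c : V} {R r Rl k Mz : ℕ}
    (hc : runX φ c₀ n h 1 c ∈ Finset.Icc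
      (((yPrmXw n ℓ h v R' qB N Wm Wp).scheduleN 1 hσB 0 (yPrmXw_ok hn hv hlay R' qB N hWm hWp) (yPrmXw_eb n ℓ h v R' qB N Wm Wp)).lo k -
        ((((yPrmXw n ℓ h v R' qB N Wm Wp).scheduleN 1 hσB 0 (yPrmXw_ok hn hv hlay R' qB N hWm hWp) (yPrmXw_eb n ℓ h v R' qB N Wm Wp)).R' : ℕ) : Site 2))
      (((yPrmXw n ℓ h v R' qB N Wm Wp).scheduleN 1 hσB 0 (yPrmXw_ok hn hv hlay R' qB N hWm hWp) (yPrmXw_eb n ℓ h v R' qB N Wm Wp)).hi k +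
        ((((yPrmXw n ℓ h v R' qB N Wm Wp).scheduleN 1 hσB 0 (yPrmXw_ok hn hv hlay R' qB N hWm hWp) (yPrmXw_eb n ℓ h v R' qB N Wm Wp)).R' : ℕ) : Site 2)))
    (hcw : c ∈ graphBall G w₀ (R - r)) (hr : Rl ≤ r) (hrR : r ≤ R) {Z : Finset V} (hZ : (↑Z : Set V) ⊆ cyl φ c Mz)
    (hclear : (Mz + 4) * (n + h.natAbs) ≤ n * (ℓ + 1))
    {Dr T : Finset V}
    (hPD : Win G (runX φ c₀ n h 1) w₀
      (((yPrmXw n ℓ h v R' qB N Wm Wp).scheduleN 1 hσB 0 (yPrmXw_ok hn hv hlay R' qB N hWm hWp) (yPrmXw_eb n ℓ h v R' qB N Wm Wp)).region k) R ⊆ Dr)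
    (hPT : Win G (runX φ c₀ n h 1) w₀
      (((yPrmXw n ℓ h v R' qB N Wm Wp).scheduleN 1 hσB 0 (yPrmXw_ok hn hv hlay R' qB N hWm hWp) (yPrmXw_eb n ℓ h v R' qB N Wm Wp)).core (k + 1)) R ⊆ T)
    {Ω : Finset V} (hDrΩ : Dr ⊆ Ω) {q : unitInterval} {Wt : Sym2 V → unitInterval} (hWD : IsSubbox (winGraphIn G Ω) Wt q Dr) {SEED : Finset V} {δ₂ : ℝ}
    (hev : 1 - δ₂ < (bondPercolation G q).real (linkIn (pgramPrism G φ c n h (3 * ℓ) Rl) SEED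
      (pgTopPieceW G φ c n h ℓ Rl σB ((yPrmXw n ℓ h v R' qB N Wm Wp).steer k (σB * runX φ c₀ n h 1 c 0)) v))) :
    ∃ Qt Ft : Finset V, Ft ⊆ T ∧ Qt ⊆ Dr ∧ Disjoint Ft Z ∧ 1 - δ₂ < (prodBernoulli Wt).real (linkIn (↑Qt : Set V) SEED Ft) := by
  set τ₀ := (yPrmXw n ℓ h v R' qB N Wm Wp).steer k (σB * runX φ c₀ n h 1 c 0) with hτ₀
  have hQB : ∀ w ∈ pgramPrism G φ c n h (3 * ℓ) Rl, w ∈ graphBall G w₀ R := fun w hw =>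
    pgramPrism_subset_graphBall_of_mem hcw hr hrR n h (3 * ℓ) hw
  have hQD : pgramPrismFin G φ c n h (3 * ℓ) Rl ⊆ Dr := fun w hw => by
    have hw' := (mem_pgramPrismFin G φ).1 hw
    exact hPD ((mem_Win G _).2 ⟨hQB w hw', runX_mem_ybandWRegion_of_link hn hv hlay c₀ hσB R' qB N hWm hWp hc hw'⟩)
  have hFt : (↑(pgTopPieceW G φ c n h ℓ Rl σB τ₀ v) : Set V) ⊆ pgramPrism G φ c n h (3 * ℓ) Rl := coe_pgTopPieceW_subset (G := G) (φ := φ) c n h ℓ Rl σB τ₀ v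
  refine ⟨pgramPrismFin G φ c n h (3 * ℓ) Rl, pgTopPieceW G φ c n h ℓ Rl σB τ₀ v, fun w hw => ?_, hQD, ?_,
    transfer_prismFin hQD hDrΩ hWD SEED _ hFt hev⟩
  · have hw' : w ∈ pgramPrism G φ c n h (3 * ℓ) Rl := hFt (Finset.mem_coe.2 hw)
    exact hPT ((mem_Win G _).2 ⟨hQB w hw', runX_mem_ybandWCore_succ_of_piece hn hv hlay c₀ hσB R' qB N hWm hWp hc hw⟩)
  · have hd := disjoint_pgTopPieceW_cyl (G := G) (φ := φ) c hn hclear Rl hσB τ₀ v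
    exact Finset.disjoint_left.2 fun w hw hz => Set.disjoint_left.1 hd (Finset.mem_coe.2 hw) (hZ (Finset.mem_coe.2 hz))

end Skelφ

end Summit.CriticalPhenomena.PercolationContinuityZ3.Theorems.Transplant

end
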